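import Mathlib
import Literature.Combinatorics.Enumerative.BregmanMinc
import Summits.ValiantsHypothesis.ValiantsHypothesis.Theorems.DivisionGapPerMultiplesHardStubBregmanFibre
import Summits.ValiantsHypothesis.ValiantsHypothesis.Theorems.DivisionGapPerMultiplesHardStubLogFactorialJensen
import Summits.ValiantsHypothesis.ValiantsHypothesis.Theorems.DivisionGapPerMultiplesHardRelDenseHostAux

/-!
# `DivisionGap.PerMultiplesHard` (stmt-ValiantsHypothesis-5068), line `uncharged-face-walk`:
stub `stub_sparseAvoidingMatchings` — few perfect matchings live inside a sparse cell set

For a cell set `E ⊆ [n]²` (cells `(row, column)`) with `#E ≤ (n − s) · D` (`D ≥ 1`, `s ≤ n`), the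
permutations `π` of `[n]` (matchings, `π` maps columns to rows) having AT MOST `s` columns `j` with
`(π j, j) ∉ E` number at most

  `C(n, s) · exp (s · log (n !) / n + (n − s) · log (D !) / D)`
  (`= C(n, s) · (n !)^{s/n} · (D !)^{(n−s)/D}`)                    (`stub_sparseAvoidingMatchings`).

Proof.
* COVER (`filter_subset_biUnion_cell`): for such a `π` the set of bad columns
  `{j : (π j, j) ∉ E}` has at most `s ≤ n` elements, so it lies in some `Q` with `#Q = s`
  (`Finset.exists_superset_card_eq`), and then `π` lies in the CELL
  `X_Q = {π : ∀ j ∉ Q, (π j, j) ∈ E}`; hence the set is covered by the `C(n, s)` cells `X_Q`,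
  `Q ∈ powersetCard s univ`, and it suffices to bound each cell by the exponential
  (`card_le_exp_of_inside_off`).
* BRÉGMAN–MINC on a cell, in the tree's logarithmic set form
  (`Literature.Combinatorics.Enumerative.log_card_le_sum_log_factorial_div`, [Bregman1973, Thm 1]):
  for nonempty `X ⊆ X_Q`, `log #X ≤ Σ_j γ(r_j)` with `γ(r) = log (r !) / r` and
  `r_j = #{π j : π ∈ X}` the row support at column `j` (`sum_log_factorial_div_le`):
  - for `j ∈ Q`, `r_j ≤ n`, so `γ(r_j) ≤ γ(n)` (`log_factorial_div_mono`): total `s · γ(n)`;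
  - for `j ∉ Q`, the row support lies in column `j` of `E` (`image_apply_subset_col`), so
    `1 ≤ r_j ≤ e_j := #{i : (i, j) ∈ E}` and `Σ_{j ∉ Q} r_j ≤ Σ_{j ∉ Q} e_j ≤ #E ≤ (n − s) · D`
    (double counting, `RelDenseHostAux.sum_card_filter_eq_card_filter`); JENSEN for the concave
    monotone `γ` on `d ≥ 1` (`RelDenseHostAux.jensen_finset`, from
    `LogFactorialJensen.le_tangent_of_gap_succ_le` / `log_factorial_div_gap_succ_le`) gives
    `Σ_{j ∉ Q} γ(r_j) ≤ (n − s) · γ(D)`.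
  Exponentiating, `#X ≤ exp (s · γ(n) + (n − s) · γ(D))`; the empty cell is trivial.
-/

noncomputable section

-- `Summit.ValiantsHypothesis.ValiantsHypothesis.…` is the tree's mandated layout (Sub = Summit).
set_option linter.dupNamespace false

namespace Summit.ValiantsHypothesis.ValiantsHypothesis.Theorems.DivisionGap.PerMultiplesHard.SparseAvoidingMatchings

open Finset Literature.Combinatorics.Enumerative
open scoped BigOperators

/-! ### Row supports of a cell -/

/-- **Row supports off `Q`.**  If every `π ∈ X` satisfies `(π j, j) ∈ E` for all columns
`j ∉ Q`, then for `j ∉ Q` the row support `{π j : π ∈ X}` of `X` at `j` lies in column `j` of `E`,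
`{i : (i, j) ∈ E}`. [folklore] -/
theorem image_apply_subset_col {n : ℕ} (E : Finset (Fin n × Fin n)) (Q : Finset (Fin n))
    (X : Finset (Equiv.Perm (Fin n))) (hXE : ∀ π ∈ X, ∀ j, j ∉ Q → (π j, j) ∈ E) {j : Fin n}
    (hj : j ∉ Q) :
    X.image (fun σ => σ j) ⊆ Finset.univ.filter fun i => (i, j) ∈ E := by
  intro i hi
  obtain ⟨π, hπ, rfl⟩ := Finset.mem_image.mp hi
  exact Finset.mem_filter.mpr ⟨Finset.mem_univ _, hXE π hπ j hj⟩

/-! ### The Brégman exponent sum of a cell -/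

/-- **The Brégman exponent sum of a cell.**  Let `#E ≤ (n − s) · D` with `D ≥ 1`, `#Q = s`, and
let `X` be a nonempty set of permutations with `(π j, j) ∈ E` for all `π ∈ X`, `j ∉ Q`.  With
`r_j = #{π j : π ∈ X}` and `γ(r) = log (r !) / r`:
`Σ_j γ(r_j) ≤ s · γ(n) + (n − s) · γ(D)` — for `j ∈ Q` by `r_j ≤ n` and monotonicity of `γ`
(`log_factorial_div_mono`), for `j ∉ Q` by `1 ≤ r_j ≤ #{i : (i, j) ∈ E}`,
`Σ_{j ∉ Q} #{i : (i, j) ∈ E} ≤ #E ≤ (n − s) · D` (double counting) and Jensen for `γ`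
(`RelDenseHostAux.jensen_finset`). [folklore] -/
theorem sum_log_factorial_div_le {n s D : ℕ} (E : Finset (Fin n × Fin n)) (hD : 1 ≤ D)
    (hE : E.card ≤ (n - s) * D) (Q : Finset (Fin n)) (hQ : Q.card = s)
    (X : Finset (Equiv.Perm (Fin n))) (hX : X.Nonempty)
    (hXE : ∀ π ∈ X, ∀ j, j ∉ Q → (π j, j) ∈ E) :
    ∑ j, Real.log (((X.image (fun σ => σ j)).card.factorial : ℕ) : ℝ) /
        ((X.image (fun σ => σ j)).card : ℝ) ≤
      (s : ℝ) * (Real.log ((n.factorial : ℕ) : ℝ) / (n : ℝ)) +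
        ((n - s : ℕ) : ℝ) * (Real.log ((D.factorial : ℕ) : ℝ) / (D : ℝ)) := by
  rw [← Finset.sum_add_sum_compl Q]
  have hcard : Qᶜ.card = n - s := by rw [Finset.card_compl, Fintype.card_fin, hQ]
  refine add_le_add ?_ ?_
  · -- columns in `Q`: `r_j ≤ n`
    refine (Finset.sum_le_sum fun j _ => log_factorial_div_mono
      ((Finset.card_le_univ _).trans_eq (Fintype.card_fin n))).trans ?_
    rw [Finset.sum_const, nsmul_eq_mul, hQ]
  · -- columns off `Q`: Jensen
    have h1 : ∀ j ∈ Qᶜ, 1 ≤ (X.image (fun σ => σ j)).card := fun j _ =>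
      Finset.card_pos.mpr (hX.image _)
    have h2 : ∑ j ∈ Qᶜ, (X.image (fun σ => σ j)).card ≤ Qᶜ.card * D := by
      calc ∑ j ∈ Qᶜ, (X.image (fun σ => σ j)).card
          ≤ ∑ j ∈ Qᶜ, (Finset.univ.filter fun i => (i, j) ∈ E).card :=
            Finset.sum_le_sum fun j hj => Finset.card_le_card
              (image_apply_subset_col E Q X hXE (Finset.mem_compl.mp hj))
        _ = (E.filter fun e => e.1 ∈ (Finset.univ : Finset (Fin n)) ∧ e.2 ∈ Qᶜ).card :=
            RelDenseHostAux.sum_card_filter_eq_card_filter E Finset.univ Qᶜ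
        _ ≤ E.card := Finset.card_filter_le _ _
        _ ≤ (n - s) * D := hE
        _ = Qᶜ.card * D := by rw [hcard]
    have hJ := RelDenseHostAux.jensen_finset Qᶜ (fun j => (X.image (fun σ => σ j)).card) D hD h1 h2
    rw [hcard] at hJ
    exact hJ

/-- **Brégman–Minc + Jensen on a cell.**  Let `#E ≤ (n − s) · D` with `D ≥ 1`, `#Q = s`, and let
`X` be a set of permutations with `(π j, j) ∈ E` for all `π ∈ X`, `j ∉ Q`.  Then
`#X ≤ exp (s · log (n !) / n + (n − s) · log (D !) / D)`: for `X = ∅` trivially, otherwise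
`log #X ≤ Σ_j log (r_j !) / r_j` by the tree's Brégman–Minc theorem in logarithmic set form
(`Literature.Combinatorics.Enumerative.log_card_le_sum_log_factorial_div`) and the exponent sum
is bounded by `sum_log_factorial_div_le`. [cite: Bregman1973, Thm 1] -/
theorem card_le_exp_of_inside_off {n s D : ℕ} (E : Finset (Fin n × Fin n)) (hD : 1 ≤ D)
    (hE : E.card ≤ (n - s) * D) (Q : Finset (Fin n)) (hQ : Q.card = s)
    (X : Finset (Equiv.Perm (Fin n))) (hXE : ∀ π ∈ X, ∀ j, j ∉ Q → (π j, j) ∈ E) :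
    (X.card : ℝ) ≤
      Real.exp ((s : ℝ) * (Real.log ((n.factorial : ℕ) : ℝ) / (n : ℝ)) +
        ((n - s : ℕ) : ℝ) * (Real.log ((D.factorial : ℕ) : ℝ) / (D : ℝ))) := by
  rcases X.eq_empty_or_nonempty with rfl | hXne
  · rw [Finset.card_empty, Nat.cast_zero]
    exact (Real.exp_pos _).le
  have hpos : (0 : ℝ) < X.card := by exact_mod_cast hXne.card_pos
  rw [← Real.exp_log hpos, Real.exp_le_exp]
  exact (log_card_le_sum_log_factorial_div X hXne).trans
    (sum_log_factorial_div_le E hD hE Q hQ X hXne hXE)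

/-! ### The cover by cells -/

/-- **Cover by cells.**  A permutation with at most `s ≤ n` columns `j` outside `E`
(`(π j, j) ∉ E`) lies in some cell `X_Q = {π : ∀ j ∉ Q, (π j, j) ∈ E}` with `#Q = s`
(enlarge the set of bad columns to size `s`, `Finset.exists_superset_card_eq`). [folklore] -/
theorem filter_subset_biUnion_cell {n s : ℕ} (E : Finset (Fin n × Fin n)) (hs : s ≤ n) :
    ((Finset.univ : Finset (Equiv.Perm (Fin n))).filter fun π : Equiv.Perm (Fin n) =>
        (Finset.univ.filter fun j : Fin n => (π j, j) ∉ E).card ≤ s) ⊆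
      (Finset.powersetCard s (Finset.univ : Finset (Fin n))).biUnion fun Q =>
        (Finset.univ : Finset (Equiv.Perm (Fin n))).filter fun π : Equiv.Perm (Fin n) =>
          ∀ j, j ∉ Q → (π j, j) ∈ E := by
  intro π hπ
  have hπ' := (Finset.mem_filter.mp hπ).2
  obtain ⟨Q, hBQ, hQ⟩ := Finset.exists_superset_card_eq hπ' (by rwa [Fintype.card_fin])
  refine Finset.mem_biUnion.mpr ⟨Q, Finset.mem_powersetCard.mpr ⟨Finset.subset_univ _, hQ⟩, ?_⟩
  refine Finset.mem_filter.mpr ⟨Finset.mem_univ _, fun j hj => ?_⟩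
  by_contra h
  exact hj (hBQ (Finset.mem_filter.mpr ⟨Finset.mem_univ _, h⟩))

/-! ### The stub -/

/-- **stub_sparseAvoidingMatchings — few perfect matchings live inside a sparse cell set.**
For a cell set `E ⊆ [n]²` with `#E ≤ (n − s) · D` (`D ≥ 1`, `s ≤ n`), the permutations `π`
having AT MOST `s` columns `j` with `(π j, j) ∉ E` number at most
`C(n, s) · exp (s · log (n !) / n + (n − s) · log (D !) / D)`
(`= C(n, s) · (n !)^{s/n} · (D !)^{(n−s)/D}`): they are covered by the `C(n, s)` cells
`X_Q = {π : ∀ j ∉ Q, (π j, j) ∈ E}`, `#Q = s` (`filter_subset_biUnion_cell`), and each cell has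
at most `exp (s · log (n !) / n + (n − s) · log (D !) / D)` elements by Brégman–Minc
(`Literature.Combinatorics.Enumerative.log_card_le_sum_log_factorial_div`) and Jensen for
`log (d !) / d` (`card_le_exp_of_inside_off`). [cite: Bregman1973, Thm 1] -/
theorem stub_sparseAvoidingMatchings :
    ∀ (n s D : ℕ) (E : Finset (Fin n × Fin n)), s ≤ n → 1 ≤ D → E.card ≤ (n - s) * D →
      ((((Finset.univ : Finset (Equiv.Perm (Fin n))).filter fun π : Equiv.Perm (Fin n) =>
            (Finset.univ.filter fun j : Fin n => (π j, j) ∉ E).card ≤ s).card : ℕ) : ℝ) ≤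
        (n.choose s : ℝ) *
          Real.exp ((s : ℝ) * (Real.log ((n.factorial : ℕ) : ℝ) / (n : ℝ)) +
            ((n - s : ℕ) : ℝ) * (Real.log ((D.factorial : ℕ) : ℝ) / (D : ℝ))) := by
  intro n s D E hs hD hE
  have hcov := (Finset.card_le_card (filter_subset_biUnion_cell E hs)).trans
    Finset.card_biUnion_le
  refine (Nat.cast_le.mpr hcov).trans ?_
  rw [Nat.cast_sum]
  refine (Finset.sum_le_sum fun Q hQ => card_le_exp_of_inside_off E hD hE Q
    (Finset.mem_powersetCard.mp hQ).2 _ fun π hπ => (Finset.mem_filter.mp hπ).2).trans ?_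
  rw [Finset.sum_const, Finset.card_powersetCard, Finset.card_univ, Fintype.card_fin, nsmul_eq_mul]

end Summit.ValiantsHypothesis.ValiantsHypothesis.Theorems.DivisionGap.PerMultiplesHard.SparseAvoidingMatchings

end
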